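import Summits.QuantumFields.YangMills.Theorems.LuscherReductionTwistedTraceScalingBOLocalisedAvgSlice
import Summits.QuantumFields.YangMills.Theorems.LuscherReductionTwistedTraceScalingFPWeightRelative
import HarnessLib

/-!
# (C1c'-λ) ★★★ THE GAUGE AVERAGE OF THE BO FUNCTION OF RECORD ALONG THE ORBIT OF A SLICE TUBE POINT, and the localised average at ANY point of that orbit
# (lane A of S-BASE, crux `TwistedTraceScaling` stmt-QuantumFields-20203, C4-CORE, the (OD) pen; steps (2)+(3) of (C1c') in orbit form, `pub/ym-fleet/ym-luscher-20007-p1/COARSE-DESIGN.md` §28.4–§28.5)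

`…BOLocalisedAvgSlice.localisedAvg_slice_bounds` bounds the `W`-localised average `A` AT the slice tube point `U* = tubePt p`; step (4') needs it at the chart points `V = c·U*^{P∘ξ'}` of the
(C1d) ball, where `A(V) ≠ A(U*)` (the weight `W` is not gauge invariant) but the GAUGE AVERAGES agree.  So the sandwich is split at the gauge-average level:
* §1 ★ `laplace_tail_le_fpWeightBar` — the Gaussian tail of `gaugeAvg_rider_sandwich` against `N̄`: `T ≤ (1+x)·4^{d/2}·e^{−c²r²/(4s²)}·N̄(s)` given the Gaussian value `hpI` at `p` and
  `|gramDet p/gramDet 0 − 1| ≤ x ≤ 1/2` (`…FPWeightRelative.inv_sqrt_le_of_ratio`);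
* §2 ★★★ `gaugeAvg_slice_bounds` — `χ_lo·e^{−ε_q}e^{−q(x*)}·(N(U*) − T) ≤ gaugeAvg f U* ≤ C_χ·e^{ε_q}e^{−q(x*)}·N(U*) + C_χ·T` for `f = boFun χ₀ (frozenProfile q_f r_f β)`, `q_f β = q_{t,b}`, under
  EXACTLY the hypotheses of `localisedAvg_slice_bounds` minus the Faddeev–Popov weight (steps (2)+(3): `…BOGaugeAvgRiderLaplace.gaugeAvg_rider_sandwich` + `rider_exp_core_bounds` + the
  indicator facts `hind` on the chart core, used by the lower half only);
* §3 ★★★ `localisedAvg_orbit_bounds` — for ANY `V` with `gaugeAvg φ U* = gaugeAvg φ V` for all `φ` (every point of the gauge orbit of `U*`, `…BOChartSliceRep.tubePt_rep_data`) and the weight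
  `W = coreWeight ε R₁'` with colour FP constant `Z`:  `Z·(χ_lo e^{−ε_q}e^{−q(x*)}(N(V) − T) − ∫𝟙_{coreᶜ}(g) f(V^{g⁻¹})dg) ≤ A(V) ≤ Z·(C_χ e^{ε_q}e^{−q(x*)}N(V) + C_χ T)`
  (`…BOLocalisedAvgFP.localisedAvg_coreWeight` at `V`); `localisedAvg_slice_bounds` is the case `V = U*`;
* §4 ★★ `gaugeAvg_slice_upper` / ★★ `localisedAvg_orbit_upper` — the upper halves WITHOUT the indicator facts (the rider is `≤ C_χ e^{−q(relLinkVec ·)}` everywhere), the form used on the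
  whole (C1d) ball where the chart point need not lie in the profile's support.
What is left for (C1c'): plug in the chart representative (`…BOChartSliceRep/Transfer`: `e^{∓q(x*)}` vs `e^{∓q(chartVec w)}`, `N(V) ∈ N̄(1 ± Cδ²)` by `…FPWeightCoreAt`), the core-complement
tail (5), rates.
HONEST FRAMING: bookkeeping for a stub of a child of the CONDITIONAL route R2b1; (C1c') (4') assembly, (5), rates, (C4), (C5), (B-ST) OPEN; C4-CORE OPEN; not infinite volume, not a gap, not Clay.
-/

set_option autoImplicit false

noncomputable section

open MeasureTheory Real
open scoped BigOperators RealInnerProductSpace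
open Literature.MathematicalPhysics.QuantumFieldTheory
open Literature.MathematicalPhysics.QuantumLattice

namespace Summit.QuantumFields.YangMills.Theorems.FemtoTransferGap.TwoLattice.ConstTube

open Summit.QuantumFields.YangMills.Theorems.FemtoTransferGap
open Summit.QuantumFields.YangMills.Theorems.FemtoTransferGap.TwoLattice.Avg
open Summit.QuantumFields.YangMills.Theorems.FemtoTransferGap.TwoLattice.Stiff (LinkSpace stiffHessian)
open Summit.QuantumFields.YangMills.Theorems.FemtoTransferGap.TwoLattice.GnChart
open Literature.MathematicalPhysics.QuantumFieldTheory.Balaban1983to89.T4CubeChartGnomonic (gnoPoint)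

variable {L : ℕ} [NeZero L]

/-! ## §1 The Gaussian tail against `N̄` -/

/-- ★ **The Laplace tail against `N̄(s)`**: with the Gaussian value `∫ e^{−a‖Aw‖²/s²} dw = (πs²/a)^{d/2}/√(gramDet p)` at `a = 1/4` and `|gramDet p/gramDet 0 − 1| ≤ x ≤ 1/2`:
`(2π²)^{−n}·(e^{−κ}·∫ e^{−¼‖Aw‖²/s²} dw) ≤ (1 + x)·4^{d/2}·e^{−κ}·N̄(s)` (`s > 0`, any real `κ`). [folklore] -/
theorem laplace_tail_le_fpWeightBar {s : ℝ} (hs : 0 < s) (p : balancedSubmodule L × (Fin 3 → Fin 3 → ℝ))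
    (hpI : ∫ w, Real.exp (-(1 / 4 * ‖laplaceMap L p w‖ ^ 2 / s ^ 2)) ∂(volume : Measure (NzSite L → Fin 3 → ℝ)) =
        (π * s ^ 2 / (1 / 4)) ^ (flatDim L / 2 : ℝ) / Real.sqrt (gramDet L p))
    {x : ℝ} (hx : |gramDet L p / gramDet L 0 - 1| ≤ x) (hx2 : x ≤ 1 / 2) (κ : ℝ) :
    ((2 * π ^ 2)⁻¹) ^ Fintype.card (NzSite L) * (Real.exp (-κ) * ∫ w, Real.exp (-(1 / 4 * ‖laplaceMap L p w‖ ^ 2 / s ^ 2)) ∂(volume : Measure (NzSite L → Fin 3 → ℝ))) ≤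
      (1 + x) * (4 : ℝ) ^ (flatDim L / 2 : ℝ) * Real.exp (-κ) * fpWeightBar L s := by
  have hG₀ := gramDet_zero_pos L
  have hsq := inv_sqrt_le_of_ratio hG₀ hx hx2
  have hX : (0 : ℝ) ≤ π * s ^ 2 := by positivity
  have h4 : (π * s ^ 2 / (1 / 4)) ^ (flatDim L / 2 : ℝ) = (4 : ℝ) ^ (flatDim L / 2 : ℝ) * (π * s ^ 2) ^ (flatDim L / 2 : ℝ) := rpow_div_inv_eq hX (by norm_num)
  rw [hpI, h4]
  unfold fpWeightBar
  have hA0 : 0 ≤ ((2 * π ^ 2)⁻¹ : ℝ) ^ Fintype.card (NzSite L) := by positivity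
  have hP0 : 0 ≤ (4 : ℝ) ^ (flatDim L / 2 : ℝ) * (π * s ^ 2) ^ (flatDim L / 2 : ℝ) := by positivity
  have key : (4 : ℝ) ^ (flatDim L / 2 : ℝ) * (π * s ^ 2) ^ (flatDim L / 2 : ℝ) / Real.sqrt (gramDet L p) ≤
      (4 : ℝ) ^ (flatDim L / 2 : ℝ) * (π * s ^ 2) ^ (flatDim L / 2 : ℝ) * ((1 + x) / Real.sqrt (gramDet L 0)) := by
    rw [div_eq_mul_one_div]; exact mul_le_mul_of_nonneg_left hsq hP0
  calc _ = ((2 * π ^ 2)⁻¹) ^ Fintype.card (NzSite L) * Real.exp (-κ) * ((4 : ℝ) ^ (flatDim L / 2 : ℝ) * (π * s ^ 2) ^ (flatDim L / 2 : ℝ) / Real.sqrt (gramDet L p)) := by ring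
    _ ≤ ((2 * π ^ 2)⁻¹) ^ Fintype.card (NzSite L) * Real.exp (-κ) * ((4 : ℝ) ^ (flatDim L / 2 : ℝ) * (π * s ^ 2) ^ (flatDim L / 2 : ℝ) * ((1 + x) / Real.sqrt (gramDet L 0))) :=
        mul_le_mul_of_nonneg_left key (by positivity)
    _ = _ := by ring

/-! ## §2 ★★★ The gauge average of the BO function of record at a slice tube point -/

/-- ★★★ **THE GAUGE AVERAGE OF THE BO FUNCTION OF RECORD AT A SLICE TUBE POINT, TWO-SIDED.**  Hypotheses: those of `…BOGaugeAvgRiderLaplace.gaugeAvg_rider_sandwich` for the record scales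
`δ = K·β^{-s}`, `ρ`, `δg = β^{-1}`, the profile `Ω = frozenProfile L q_f r_f β` with `q_f β = stiffGaussExp L t b` (`t,b ≥ 0`), `q_f` colour blind, a class-function amplitude `0 ≤ χ₀ ≤ C_χ`, the
support inclusion `supp (boFun χ₀ Ω) ⊆ supp recordChi`; the indicator facts `hind` on the chart core are used by the lower half only (`χ_lo = 0` switches it off).  Then
`χ_lo·e^{−ε_q}e^{−q(x*)}(N(U*) − T) ≤ gaugeAvg (boFun χ₀ Ω) U* ≤ C_χ·e^{ε_q}·e^{−q(x*)}·N(U*) + C_χ·T`. [cite: Luscher1983, §3] -/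
theorem gaugeAvg_slice_bounds (hL : Nonempty (NzSite L)) {s K M : ℝ} {β : ℝ} (hs : 0 < powScale 1 β)
    (p : balancedSubmodule L × (Fin 3 → Fin 3 → ℝ))
    {εT Mt : ℝ} (hM0 : 0 ≤ Mt) (hεT : 0 < εT)
    (hT : ∀ (ξ : basedSubmodule L) (q : balancedSubmodule L × (Fin 3 → Fin 3 → ℝ)), ‖ξ‖ < εT → ‖q‖ < εT →
      ‖basedFn L (ξ, q) - basedFn L (0, q) - basedLin L q ξ‖ ≤ Mt * ‖ξ‖ ^ 2)
    {εC : ℝ} (hC : ∀ q : balancedSubmodule L × (Fin 3 → Fin 3 → ℝ), ‖q‖ < εC →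
      ∀ ξ : basedSubmodule L, ‖ξ‖ ≤ 4 * sliceConst L * ‖(gaugeModes L).starProjection (basedLin L q ξ)‖)
    (hpT : ‖p‖ < εT) (hpC : ‖p‖ < εC) (hp40 : ‖p‖ ≤ 1 / 40)
    (hslice : (gaugeModes L).starProjection (linkEmbed L (p.1 : Edge 3 L → Fin 3 → ℝ)) = 0)
    {ρ₁ : ℝ} (hU : tubePt L p ∈ fatTubeRho L (fun b' => K * powScale s b') (fun _ => ρ₁) β)
    {r R₁ : ℝ} (hr0 : 0 ≤ r) (hrR : r ≤ R₁) (hR1 : R₁ ≤ 1 / 2) (hR1T : R₁ < εT) (hcore : ρ₁ + 8 * r ≤ M * (K * powScale s β))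
    (hsupp : 3 * ((L : ℝ) - 1) * (ρ₁ + M * (K * powScale s β)) ≤ R₁)
    (hθ : (Mt + 2 * ‖basedLin L p‖) * R₁ * (4 * sliceConst L) ≤ 1 / 4)
    -- the profile and the amplitude
    {t b : ℝ} (ht : 0 ≤ t) (hb : 0 ≤ b) {qf : ℝ → LinkSpace L → ℝ} (hqfm : ∀ β', Measurable (qf β')) (hqf0 : ∀ β' x, 0 ≤ qf β' x)
    (hqfinv : ∀ β' (g : SU2) (x : LinkSpace L), qf β' (adL L g x) = qf β' x) (hqf : qf β = stiffGaussExp L t b) (rf : ℝ → ℝ)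
    {χ₀ : GaugeConfig 3 1 SU2 → ℝ} (hχm : Measurable χ₀) {Cχ : ℝ} (hχ0 : ∀ u, 0 ≤ χ₀ u) (hCχ : ∀ u, χ₀ u ≤ Cχ)
    (hχinv : ∀ (c : SU2) (u : GaugeConfig 3 1 SU2), χ₀ (gaugeTransform (fun _ : Site 3 1 => c) u) = χ₀ u)
    (hbo : ∀ U, boFun L χ₀ (frozenProfile L qf rf β) U ≠ 0 → recordChi L s K M β U ≠ 0)
    -- indicator facts on the chart core (used by the lower bound only)
    {χlo : ℝ} (hχlo : 0 ≤ χlo)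
    (hind : ∀ w : NzSite L → Fin 3 → ℝ, ‖w‖ ≤ r → gaugeTransform (basedExt L fun y => gnoPoint (w y)) (tubePt L p) ∈ orthoTubeSet L ∧
      χlo ≤ χ₀ (slowMean L (gaugeTransform (basedExt L fun y => gnoPoint (w y)) (tubePt L p))) ∧
      ‖relLinkVec L (gaugeTransform (basedExt L fun y => gnoPoint (w y)) (tubePt L p))‖ ≤ rf β) :
    let n := Fintype.card (NzSite L)
    let sg := powScale 1 β
    let c := 1 / (4 * sliceConst L)
    let T := ((2 * π ^ 2)⁻¹) ^ n * (Real.exp (-(c ^ 2 * r ^ 2 / (4 * sg ^ 2))) * ∫ w, Real.exp (-(1 / 4 * ‖laplaceMap L p w‖ ^ 2 / sg ^ 2)))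
    let D := ‖basedLin L p‖ * r + Mt * r ^ 2
    let εq := (96 * t + b) * D * (2 * ‖linkEmbed L (p.1 : Edge 3 L → Fin 3 → ℝ)‖ + D)
    χlo * Real.exp (-εq) * Real.exp (-stiffGaussExp L t b (linkEmbed L (p.1 : Edge 3 L → Fin 3 → ℝ))) * (gaugeAvg (recordChi L s K M β) (tubePt L p) - T) ≤
        gaugeAvg (boFun L χ₀ (frozenProfile L qf rf β)) (tubePt L p) ∧
      gaugeAvg (boFun L χ₀ (frozenProfile L qf rf β)) (tubePt L p) ≤
        Cχ * Real.exp εq * Real.exp (-stiffGaussExp L t b (linkEmbed L (p.1 : Edge 3 L → Fin 3 → ℝ))) * gaugeAvg (recordChi L s K M β) (tubePt L p) + Cχ * T := by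
  intro n sg c T D εq
  have hCχ0 : 0 ≤ Cχ := (hχ0 1).trans (hCχ 1)
  -- the BO function and its rider
  set Ω := frozenProfile L qf rf β with hΩ
  set Rprof : LinkSpace L → ℝ := fun x => Real.exp (-(qf β x)) * (Metric.closedBall (0 : LinkSpace L) (rf β)).indicator (fun _ => (1 : ℝ)) x with hRprof
  set Rf := boFun L χ₀ Rprof with hRf
  obtain ⟨hRpm, hRp⟩ := stiffRider_props (L := L) (q := qf β) (hqfm β) (hqf0 β) (rf β)
  have hχabs : ∀ u, |χ₀ u| ≤ Cχ := fun u => by rw [abs_of_nonneg (hχ0 u)]; exact hCχ u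
  -- properties of the rider
  have hRm : Measurable Rf := measurable_boFun L hχm hRpm
  have hR0 : ∀ U, 0 ≤ Rf U := fun U => by
    rw [hRf]; unfold boFun; exact mul_nonneg (Set.indicator_nonneg (fun _ _ => zero_le_one) _) (mul_nonneg (hχ0 _) (hRp _).1)
  have hRmax : ∀ U, Rf U ≤ Cχ := fun U => by
    have h := abs_boFun_le L hχabs (fun x => (hRp x).2) U
    rw [mul_one] at h; exact (le_abs_self _).trans h
  have hRinv : ∀ (c' : SU2) (U : GaugeConfig 3 L SU2), Rf (gaugeTransform (fun _ : Site 3 L => c') U) = Rf U :=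
    boFun_conj hχinv (fun c' x => stiffRider_adL (hqfinv β) (rf β) c' x)
  -- `f = recordChi · Rf`
  have hfac : (fun U => recordWeightRho L (fun b' => K * powScale s b') (fun b' => M * (K * powScale s b')) (powScale 1) β U * Rf U) = boFun L χ₀ Ω := by
    funext U
    show recordChi L s K M β U * Rf U = boFun L χ₀ Ω U
    rw [hΩ, boFun_frozenProfile_eq_recordChi_mul_rider s K M β qf rf χ₀ hbo U, hRf]
    rfl
  -- core bounds of the rider
  set x' : LinkSpace L := linkEmbed L (p.1 : Edge 3 L → Fin 3 → ℝ) with hx'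
  have hRcore : ∀ w : NzSite L → Fin 3 → ℝ, ‖w‖ ≤ r →
      χlo * Real.exp (-εq) * Real.exp (-stiffGaussExp L t b x') ≤ Rf (gaugeTransform (basedExt L fun y => gnoPoint (w y)) (tubePt L p)) ∧
        Rf (gaugeTransform (basedExt L fun y => gnoPoint (w y)) (tubePt L p)) ≤ Cχ * Real.exp εq * Real.exp (-stiffGaussExp L t b x') := by
    intro w hw
    set Uw := gaugeTransform (basedExt L fun y => gnoPoint (w y)) (tubePt L p) with hUw
    obtain ⟨_, hlo, hhi⟩ := rider_exp_core_bounds (L := L) ht hb p hM0 hT hpT hp40 (lt_of_le_of_lt hrR hR1T) hw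
    rw [← hUw, ← hx'] at hlo hhi
    obtain ⟨htube, hχw, hball⟩ := hind w hw
    rw [← hUw] at htube hχw hball
    have hval : Rf Uw = χ₀ (slowMean L Uw) * Real.exp (-stiffGaussExp L t b (relLinkVec L Uw)) := by
      rw [hRf]; unfold boFun
      rw [Set.indicator_of_mem htube, one_mul, hRprof]; dsimp only
      rw [Set.indicator_of_mem (by rwa [Metric.mem_closedBall, dist_zero_right]), mul_one, hqf]
    rw [hval]
    constructor
    · calc χlo * Real.exp (-εq) * Real.exp (-stiffGaussExp L t b x') = χlo * (Real.exp (-stiffGaussExp L t b x') * Real.exp (-εq)) := by ring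
        _ ≤ χ₀ (slowMean L Uw) * Real.exp (-stiffGaussExp L t b (relLinkVec L Uw)) := mul_le_mul hχw hlo (by positivity) (hχ0 _)
    · calc χ₀ (slowMean L Uw) * Real.exp (-stiffGaussExp L t b (relLinkVec L Uw)) ≤ Cχ * (Real.exp (-stiffGaussExp L t b x') * Real.exp εq) :=
            mul_le_mul (hCχ _) hhi (Real.exp_pos _).le hCχ0
        _ = Cχ * Real.exp εq * Real.exp (-stiffGaussExp L t b x') := by ring
  have hrlo0 : 0 ≤ χlo * Real.exp (-εq) * Real.exp (-stiffGaussExp L t b x') := by positivity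
  have hrhi0 : 0 ≤ Cχ * Real.exp εq * Real.exp (-stiffGaussExp L t b x') := by positivity
  -- (2)+(3): the rider sandwich at the slice tube point
  have hsand := gaugeAvg_rider_sandwich L hL (δ := fun b' => K * powScale s b') (ρ := fun b' => M * (K * powScale s b')) (δg := powScale 1) hs p hM0 hεT hT hC hpT hpC hp40 hslice hU
    hr0 hrR hR1 hR1T hcore hsupp hθ hRm hR0 hRmax hRinv hrlo0 hrhi0 hRcore
  dsimp only at hsand
  rw [hfac] at hsand
  exact hsand

/-! ## §3 ★★★ The localised average at any point of the orbit -/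

/-- ★★★ **THE LOCALISED AVERAGE OF THE BO FUNCTION OF RECORD AT ANY POINT OF THE ORBIT OF A SLICE TUBE POINT.**  Hypotheses: those of `gaugeAvg_slice_bounds`, the Faddeev–Popov weight
`W = coreWeight ε R₁'` with colour FP constant `Z ≥ 0`, and a configuration `V` whose gauge averages agree with those of `U* = tubePt p` (every point of the orbit of `U*`).  Then
`Z·(χ_lo e^{−ε_q}e^{−q(x*)}(N(V) − T) − ∫𝟙_{coreᶜ}(g) f(V^{g⁻¹})dg) ≤ A(V) ≤ Z·(C_χ e^{ε_q}e^{−q(x*)}N(V) + C_χ T)`, `A(V) = ∫ W(g) f(V^{g⁻¹}) dg`, `N = gaugeAvg recordChi`. [cite: Luscher1983, §3] -/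
theorem localisedAvg_orbit_bounds (hL : Nonempty (NzSite L)) {s K M : ℝ} {β : ℝ} (hs : 0 < powScale 1 β)
    (p : balancedSubmodule L × (Fin 3 → Fin 3 → ℝ))
    {εT Mt : ℝ} (hM0 : 0 ≤ Mt) (hεT : 0 < εT)
    (hT : ∀ (ξ : basedSubmodule L) (q : balancedSubmodule L × (Fin 3 → Fin 3 → ℝ)), ‖ξ‖ < εT → ‖q‖ < εT →
      ‖basedFn L (ξ, q) - basedFn L (0, q) - basedLin L q ξ‖ ≤ Mt * ‖ξ‖ ^ 2)
    {εC : ℝ} (hC : ∀ q : balancedSubmodule L × (Fin 3 → Fin 3 → ℝ), ‖q‖ < εC →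
      ∀ ξ : basedSubmodule L, ‖ξ‖ ≤ 4 * sliceConst L * ‖(gaugeModes L).starProjection (basedLin L q ξ)‖)
    (hpT : ‖p‖ < εT) (hpC : ‖p‖ < εC) (hp40 : ‖p‖ ≤ 1 / 40)
    (hslice : (gaugeModes L).starProjection (linkEmbed L (p.1 : Edge 3 L → Fin 3 → ℝ)) = 0)
    {ρ₁ : ℝ} (hU : tubePt L p ∈ fatTubeRho L (fun b' => K * powScale s b') (fun _ => ρ₁) β)
    {r R₁ : ℝ} (hr0 : 0 ≤ r) (hrR : r ≤ R₁) (hR1 : R₁ ≤ 1 / 2) (hR1T : R₁ < εT) (hcore : ρ₁ + 8 * r ≤ M * (K * powScale s β))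
    (hsupp : 3 * ((L : ℝ) - 1) * (ρ₁ + M * (K * powScale s β)) ≤ R₁)
    (hθ : (Mt + 2 * ‖basedLin L p‖) * R₁ * (4 * sliceConst L) ≤ 1 / 4)
    {t b : ℝ} (ht : 0 ≤ t) (hb : 0 ≤ b) {qf : ℝ → LinkSpace L → ℝ} (hqfm : ∀ β', Measurable (qf β')) (hqf0 : ∀ β' x, 0 ≤ qf β' x)
    (hqfinv : ∀ β' (g : SU2) (x : LinkSpace L), qf β' (adL L g x) = qf β' x) (hqf : qf β = stiffGaussExp L t b) (rf : ℝ → ℝ)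
    {χ₀ : GaugeConfig 3 1 SU2 → ℝ} (hχm : Measurable χ₀) {Cχ : ℝ} (hχ0 : ∀ u, 0 ≤ χ₀ u) (hCχ : ∀ u, χ₀ u ≤ Cχ)
    (hχinv : ∀ (c : SU2) (u : GaugeConfig 3 1 SU2), χ₀ (gaugeTransform (fun _ : Site 3 1 => c) u) = χ₀ u)
    (hbo : ∀ U, boFun L χ₀ (frozenProfile L qf rf β) U ≠ 0 → recordChi L s K M β U ≠ 0)
    (ε R₁' : ℝ) {Z : ℝ} (hZ0 : 0 ≤ Z) (hZ : ∀ g : Site 3 L → SU2, ∫ c, fpWeight L ε (fun x => c * g x) ∂haarProbability SU2 = Z)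
    {χlo : ℝ} (hχlo : 0 ≤ χlo)
    (hind : ∀ w : NzSite L → Fin 3 → ℝ, ‖w‖ ≤ r → gaugeTransform (basedExt L fun y => gnoPoint (w y)) (tubePt L p) ∈ orthoTubeSet L ∧
      χlo ≤ χ₀ (slowMean L (gaugeTransform (basedExt L fun y => gnoPoint (w y)) (tubePt L p))) ∧
      ‖relLinkVec L (gaugeTransform (basedExt L fun y => gnoPoint (w y)) (tubePt L p))‖ ≤ rf β)
    -- the point of the orbit
    {V : GaugeConfig 3 L SU2} (hV : ∀ φ : GaugeConfig 3 L SU2 → ℝ, gaugeAvg φ (tubePt L p) = gaugeAvg φ V) :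
    let n := Fintype.card (NzSite L)
    let sg := powScale 1 β
    let c := 1 / (4 * sliceConst L)
    let T := ((2 * π ^ 2)⁻¹) ^ n * (Real.exp (-(c ^ 2 * r ^ 2 / (4 * sg ^ 2))) * ∫ w, Real.exp (-(1 / 4 * ‖laplaceMap L p w‖ ^ 2 / sg ^ 2)))
    let D := ‖basedLin L p‖ * r + Mt * r ^ 2
    let εq := (96 * t + b) * D * (2 * ‖linkEmbed L (p.1 : Edge 3 L → Fin 3 → ℝ)‖ + D)
    Z * (χlo * Real.exp (-εq) * Real.exp (-stiffGaussExp L t b (linkEmbed L (p.1 : Edge 3 L → Fin 3 → ℝ))) * (gaugeAvg (recordChi L s K M β) V - T) -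
        ∫ g, (coreSet L R₁')ᶜ.indicator (fun g => boFun L χ₀ (frozenProfile L qf rf β) (gaugeTransform g⁻¹ V)) g ∂gaugeMeasure L) ≤
      ∫ g, coreWeight L ε R₁' g * boFun L χ₀ (frozenProfile L qf rf β) (gaugeTransform g⁻¹ V) ∂gaugeMeasure L ∧
    ∫ g, coreWeight L ε R₁' g * boFun L χ₀ (frozenProfile L qf rf β) (gaugeTransform g⁻¹ V) ∂gaugeMeasure L ≤
      Z * (Cχ * Real.exp εq * Real.exp (-stiffGaussExp L t b (linkEmbed L (p.1 : Edge 3 L → Fin 3 → ℝ))) * gaugeAvg (recordChi L s K M β) V + Cχ * T) := by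
  intro n sg c T D εq
  obtain ⟨hlo', hhi'⟩ := gaugeAvg_slice_bounds (L := L) hL hs p hM0 hεT hT hC hpT hpC hp40 hslice hU hr0 hrR hR1 hR1T hcore hsupp hθ ht hb hqfm hqf0 hqfinv hqf rf hχm hχ0 hCχ
    hχinv hbo hχlo hind
  rw [hV, hV] at hlo'
  rw [hV, hV] at hhi'
  -- properties of `f = boFun χ₀ Ω`
  set Ω := frozenProfile L qf rf β with hΩ
  have hχabs : ∀ u, |χ₀ u| ≤ Cχ := fun u => by rw [abs_of_nonneg (hχ0 u)]; exact hCχ u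
  have hΩm : Measurable Ω := measurable_frozenProfile hqfm rf β
  have hfm : Measurable (boFun L χ₀ Ω) := measurable_boFun L hχm hΩm
  have hfb : ∀ U, |boFun L χ₀ Ω U| ≤ Cχ * 1 := fun U => abs_boFun_le L hχabs (abs_frozenProfile_le hqf0 rf β) U
  have hf0 : ∀ U, 0 ≤ boFun L χ₀ Ω U := fun U => by
    unfold boFun; exact mul_nonneg (Set.indicator_nonneg (fun _ _ => zero_le_one) _) (mul_nonneg (hχ0 _) (frozenProfile_mem_Icc hqf0 rf β _).1)
  have hfinv : ∀ (c' : SU2) (U : GaugeConfig 3 L SU2), boFun L χ₀ Ω (gaugeTransform (fun _ : Site 3 L => c') U) = boFun L χ₀ Ω U :=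
    boFun_conj hχinv (fun c' x => frozenProfile_adL hqfinv rf β c' x)
  -- (1): the colour FP identity and the core sandwich at `V`
  obtain ⟨_, hAup, hAlo⟩ := localisedAvg_coreWeight (L := L) ε R₁' hZ0 hZ hfm hfb hf0 hfinv V
  constructor
  · refine le_trans (mul_le_mul_of_nonneg_left (sub_le_sub_right hlo' _) hZ0) (le_of_eq ?_)
    exact hAlo
  · exact le_trans hAup (mul_le_mul_of_nonneg_left hhi' hZ0)

/-! ## §4 The upper halves without indicator facts -/

/-- ★★ **Upper half of `gaugeAvg_slice_bounds` WITHOUT the indicator facts**: `gaugeAvg (boFun χ₀ Ω) U* ≤ C_χ·e^{ε_q}·e^{−q(x*)}·N(U*) + C_χ·T` (the rider is bounded above by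
`C_χ·e^{−q(relLinkVec ·)}` regardless of tube membership, so no fact about the chart core is needed — this is the form used on the WHOLE (C1d) ball). [cite: Luscher1983, §3] -/
theorem gaugeAvg_slice_upper (hL : Nonempty (NzSite L)) {s K M : ℝ} {β : ℝ} (hs : 0 < powScale 1 β)
    (p : balancedSubmodule L × (Fin 3 → Fin 3 → ℝ))
    {εT Mt : ℝ} (hM0 : 0 ≤ Mt) (hεT : 0 < εT)
    (hT : ∀ (ξ : basedSubmodule L) (q : balancedSubmodule L × (Fin 3 → Fin 3 → ℝ)), ‖ξ‖ < εT → ‖q‖ < εT →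
      ‖basedFn L (ξ, q) - basedFn L (0, q) - basedLin L q ξ‖ ≤ Mt * ‖ξ‖ ^ 2)
    {εC : ℝ} (hC : ∀ q : balancedSubmodule L × (Fin 3 → Fin 3 → ℝ), ‖q‖ < εC →
      ∀ ξ : basedSubmodule L, ‖ξ‖ ≤ 4 * sliceConst L * ‖(gaugeModes L).starProjection (basedLin L q ξ)‖)
    (hpT : ‖p‖ < εT) (hpC : ‖p‖ < εC) (hp40 : ‖p‖ ≤ 1 / 40)
    (hslice : (gaugeModes L).starProjection (linkEmbed L (p.1 : Edge 3 L → Fin 3 → ℝ)) = 0)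
    {ρ₁ : ℝ} (hU : tubePt L p ∈ fatTubeRho L (fun b' => K * powScale s b') (fun _ => ρ₁) β)
    {r R₁ : ℝ} (hr0 : 0 ≤ r) (hrR : r ≤ R₁) (hR1 : R₁ ≤ 1 / 2) (hR1T : R₁ < εT) (hcore : ρ₁ + 8 * r ≤ M * (K * powScale s β))
    (hsupp : 3 * ((L : ℝ) - 1) * (ρ₁ + M * (K * powScale s β)) ≤ R₁)
    (hθ : (Mt + 2 * ‖basedLin L p‖) * R₁ * (4 * sliceConst L) ≤ 1 / 4)
    {t b : ℝ} (ht : 0 ≤ t) (hb : 0 ≤ b) {qf : ℝ → LinkSpace L → ℝ} (hqfm : ∀ β', Measurable (qf β')) (hqf0 : ∀ β' x, 0 ≤ qf β' x)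
    (hqfinv : ∀ β' (g : SU2) (x : LinkSpace L), qf β' (adL L g x) = qf β' x) (hqf : qf β = stiffGaussExp L t b) (rf : ℝ → ℝ)
    {χ₀ : GaugeConfig 3 1 SU2 → ℝ} (hχm : Measurable χ₀) {Cχ : ℝ} (hχ0 : ∀ u, 0 ≤ χ₀ u) (hCχ : ∀ u, χ₀ u ≤ Cχ)
    (hχinv : ∀ (c : SU2) (u : GaugeConfig 3 1 SU2), χ₀ (gaugeTransform (fun _ : Site 3 1 => c) u) = χ₀ u)
    (hbo : ∀ U, boFun L χ₀ (frozenProfile L qf rf β) U ≠ 0 → recordChi L s K M β U ≠ 0) :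
    let n := Fintype.card (NzSite L)
    let sg := powScale 1 β
    let c := 1 / (4 * sliceConst L)
    let T := ((2 * π ^ 2)⁻¹) ^ n * (Real.exp (-(c ^ 2 * r ^ 2 / (4 * sg ^ 2))) * ∫ w, Real.exp (-(1 / 4 * ‖laplaceMap L p w‖ ^ 2 / sg ^ 2)))
    let D := ‖basedLin L p‖ * r + Mt * r ^ 2
    let εq := (96 * t + b) * D * (2 * ‖linkEmbed L (p.1 : Edge 3 L → Fin 3 → ℝ)‖ + D)
    gaugeAvg (boFun L χ₀ (frozenProfile L qf rf β)) (tubePt L p) ≤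
      Cχ * Real.exp εq * Real.exp (-stiffGaussExp L t b (linkEmbed L (p.1 : Edge 3 L → Fin 3 → ℝ))) * gaugeAvg (recordChi L s K M β) (tubePt L p) + Cχ * T := by
  intro n sg c T D εq
  have hCχ0 : 0 ≤ Cχ := (hχ0 1).trans (hCχ 1)
  set Ω := frozenProfile L qf rf β with hΩ
  set Rprof : LinkSpace L → ℝ := fun x => Real.exp (-(qf β x)) * (Metric.closedBall (0 : LinkSpace L) (rf β)).indicator (fun _ => (1 : ℝ)) x with hRprof
  set Rf := boFun L χ₀ Rprof with hRf
  obtain ⟨hRpm, hRp⟩ := stiffRider_props (L := L) (q := qf β) (hqfm β) (hqf0 β) (rf β)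
  have hχabs : ∀ u, |χ₀ u| ≤ Cχ := fun u => by rw [abs_of_nonneg (hχ0 u)]; exact hCχ u
  have hRm : Measurable Rf := measurable_boFun L hχm hRpm
  have hR0 : ∀ U, 0 ≤ Rf U := fun U => by
    rw [hRf]; unfold boFun; exact mul_nonneg (Set.indicator_nonneg (fun _ _ => zero_le_one) _) (mul_nonneg (hχ0 _) (hRp _).1)
  have hRmax : ∀ U, Rf U ≤ Cχ := fun U => by
    have h := abs_boFun_le L hχabs (fun x => (hRp x).2) U
    rw [mul_one] at h; exact (le_abs_self _).trans h
  have hRinv : ∀ (c' : SU2) (U : GaugeConfig 3 L SU2), Rf (gaugeTransform (fun _ : Site 3 L => c') U) = Rf U :=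
    boFun_conj hχinv (fun c' x => stiffRider_adL (hqfinv β) (rf β) c' x)
  have hfac : (fun U => recordWeightRho L (fun b' => K * powScale s b') (fun b' => M * (K * powScale s b')) (powScale 1) β U * Rf U) = boFun L χ₀ Ω := by
    funext U
    show recordChi L s K M β U * Rf U = boFun L χ₀ Ω U
    rw [hΩ, boFun_frozenProfile_eq_recordChi_mul_rider s K M β qf rf χ₀ hbo U, hRf]
    rfl
  set x' : LinkSpace L := linkEmbed L (p.1 : Edge 3 L → Fin 3 → ℝ) with hx'
  -- the rider is bounded above by `C_χ e^{−q(relLinkVec ·)}` everywhere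
  have hRle : ∀ U, Rf U ≤ Cχ * Real.exp (-stiffGaussExp L t b (relLinkVec L U)) := fun U => by
    rw [hRf]; unfold boFun; rw [hRprof]; dsimp only; rw [hqf]
    have hi1 : (orthoTubeSet L).indicator (fun _ => (1 : ℝ)) U ≤ 1 := Set.indicator_le_self' (fun _ _ => zero_le_one) U
    have hi0 : 0 ≤ (orthoTubeSet L).indicator (fun _ => (1 : ℝ)) U := Set.indicator_nonneg (fun _ _ => zero_le_one) U
    have hj1 : (Metric.closedBall (0 : LinkSpace L) (rf β)).indicator (fun _ => (1 : ℝ)) (relLinkVec L U) ≤ 1 := Set.indicator_le_self' (fun _ _ => zero_le_one) _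
    have hj0 : 0 ≤ (Metric.closedBall (0 : LinkSpace L) (rf β)).indicator (fun _ => (1 : ℝ)) (relLinkVec L U) := Set.indicator_nonneg (fun _ _ => zero_le_one) _
    have he0 : 0 ≤ Real.exp (-stiffGaussExp L t b (relLinkVec L U)) := (Real.exp_pos _).le
    calc _ ≤ 1 * (Cχ * (Real.exp (-stiffGaussExp L t b (relLinkVec L U)) * 1)) := by
          refine mul_le_mul hi1 (mul_le_mul (hCχ _) (mul_le_mul_of_nonneg_left hj1 he0) (mul_nonneg he0 hj0) hCχ0) (mul_nonneg (hχ0 _) (mul_nonneg he0 hj0)) zero_le_one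
      _ = _ := by ring
  have hRcore : ∀ w : NzSite L → Fin 3 → ℝ, ‖w‖ ≤ r →
      0 ≤ Rf (gaugeTransform (basedExt L fun y => gnoPoint (w y)) (tubePt L p)) ∧
        Rf (gaugeTransform (basedExt L fun y => gnoPoint (w y)) (tubePt L p)) ≤ Cχ * Real.exp εq * Real.exp (-stiffGaussExp L t b x') := by
    intro w hw
    obtain ⟨_, _, hhi⟩ := rider_exp_core_bounds (L := L) ht hb p hM0 hT hpT hp40 (lt_of_le_of_lt hrR hR1T) hw
    rw [← hx'] at hhi
    refine ⟨hR0 _, (hRle _).trans ?_⟩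
    calc Cχ * Real.exp (-stiffGaussExp L t b (relLinkVec L (gaugeTransform (basedExt L fun y => gnoPoint (w y)) (tubePt L p)))) ≤ Cχ * (Real.exp (-stiffGaussExp L t b x') * Real.exp εq) :=
          mul_le_mul_of_nonneg_left hhi hCχ0
      _ = _ := by ring
  have hrhi0 : 0 ≤ Cχ * Real.exp εq * Real.exp (-stiffGaussExp L t b x') := by positivity
  have hsand := gaugeAvg_rider_sandwich L hL (δ := fun b' => K * powScale s b') (ρ := fun b' => M * (K * powScale s b')) (δg := powScale 1) hs p hM0 hεT hT hC hpT hpC hp40 hslice hU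
    hr0 hrR hR1 hR1T hcore hsupp hθ hRm hR0 hRmax hRinv le_rfl hrhi0 hRcore
  dsimp only at hsand
  rw [hfac] at hsand
  exact hsand.2

/-- ★★ **Upper half of `localisedAvg_orbit_bounds` WITHOUT the indicator facts**: `A(V) ≤ Z·(C_χ·e^{ε_q}·e^{−q(x*)}·N(V) + C_χ·T)` at every point `V` of the orbit of the slice tube point.
[cite: Luscher1983, §3] -/
theorem localisedAvg_orbit_upper (hL : Nonempty (NzSite L)) {s K M : ℝ} {β : ℝ} (hs : 0 < powScale 1 β)
    (p : balancedSubmodule L × (Fin 3 → Fin 3 → ℝ))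
    {εT Mt : ℝ} (hM0 : 0 ≤ Mt) (hεT : 0 < εT)
    (hT : ∀ (ξ : basedSubmodule L) (q : balancedSubmodule L × (Fin 3 → Fin 3 → ℝ)), ‖ξ‖ < εT → ‖q‖ < εT →
      ‖basedFn L (ξ, q) - basedFn L (0, q) - basedLin L q ξ‖ ≤ Mt * ‖ξ‖ ^ 2)
    {εC : ℝ} (hC : ∀ q : balancedSubmodule L × (Fin 3 → Fin 3 → ℝ), ‖q‖ < εC →
      ∀ ξ : basedSubmodule L, ‖ξ‖ ≤ 4 * sliceConst L * ‖(gaugeModes L).starProjection (basedLin L q ξ)‖)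
    (hpT : ‖p‖ < εT) (hpC : ‖p‖ < εC) (hp40 : ‖p‖ ≤ 1 / 40)
    (hslice : (gaugeModes L).starProjection (linkEmbed L (p.1 : Edge 3 L → Fin 3 → ℝ)) = 0)
    {ρ₁ : ℝ} (hU : tubePt L p ∈ fatTubeRho L (fun b' => K * powScale s b') (fun _ => ρ₁) β)
    {r R₁ : ℝ} (hr0 : 0 ≤ r) (hrR : r ≤ R₁) (hR1 : R₁ ≤ 1 / 2) (hR1T : R₁ < εT) (hcore : ρ₁ + 8 * r ≤ M * (K * powScale s β))
    (hsupp : 3 * ((L : ℝ) - 1) * (ρ₁ + M * (K * powScale s β)) ≤ R₁)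
    (hθ : (Mt + 2 * ‖basedLin L p‖) * R₁ * (4 * sliceConst L) ≤ 1 / 4)
    {t b : ℝ} (ht : 0 ≤ t) (hb : 0 ≤ b) {qf : ℝ → LinkSpace L → ℝ} (hqfm : ∀ β', Measurable (qf β')) (hqf0 : ∀ β' x, 0 ≤ qf β' x)
    (hqfinv : ∀ β' (g : SU2) (x : LinkSpace L), qf β' (adL L g x) = qf β' x) (hqf : qf β = stiffGaussExp L t b) (rf : ℝ → ℝ)
    {χ₀ : GaugeConfig 3 1 SU2 → ℝ} (hχm : Measurable χ₀) {Cχ : ℝ} (hχ0 : ∀ u, 0 ≤ χ₀ u) (hCχ : ∀ u, χ₀ u ≤ Cχ)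
    (hχinv : ∀ (c : SU2) (u : GaugeConfig 3 1 SU2), χ₀ (gaugeTransform (fun _ : Site 3 1 => c) u) = χ₀ u)
    (hbo : ∀ U, boFun L χ₀ (frozenProfile L qf rf β) U ≠ 0 → recordChi L s K M β U ≠ 0)
    (ε R₁' : ℝ) {Z : ℝ} (hZ0 : 0 ≤ Z) (hZ : ∀ g : Site 3 L → SU2, ∫ c, fpWeight L ε (fun x => c * g x) ∂haarProbability SU2 = Z)
    {V : GaugeConfig 3 L SU2} (hV : ∀ φ : GaugeConfig 3 L SU2 → ℝ, gaugeAvg φ (tubePt L p) = gaugeAvg φ V) :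
    let n := Fintype.card (NzSite L)
    let sg := powScale 1 β
    let c := 1 / (4 * sliceConst L)
    let T := ((2 * π ^ 2)⁻¹) ^ n * (Real.exp (-(c ^ 2 * r ^ 2 / (4 * sg ^ 2))) * ∫ w, Real.exp (-(1 / 4 * ‖laplaceMap L p w‖ ^ 2 / sg ^ 2)))
    let D := ‖basedLin L p‖ * r + Mt * r ^ 2
    let εq := (96 * t + b) * D * (2 * ‖linkEmbed L (p.1 : Edge 3 L → Fin 3 → ℝ)‖ + D)
    ∫ g, coreWeight L ε R₁' g * boFun L χ₀ (frozenProfile L qf rf β) (gaugeTransform g⁻¹ V) ∂gaugeMeasure L ≤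
      Z * (Cχ * Real.exp εq * Real.exp (-stiffGaussExp L t b (linkEmbed L (p.1 : Edge 3 L → Fin 3 → ℝ))) * gaugeAvg (recordChi L s K M β) V + Cχ * T) := by
  intro n sg c T D εq
  have hhi' := gaugeAvg_slice_upper (L := L) hL hs p hM0 hεT hT hC hpT hpC hp40 hslice hU hr0 hrR hR1 hR1T hcore hsupp hθ ht hb hqfm hqf0 hqfinv hqf rf hχm hχ0 hCχ hχinv hbo
  dsimp only at hhi'
  rw [hV, hV] at hhi'
  set Ω := frozenProfile L qf rf β with hΩ
  have hχabs : ∀ u, |χ₀ u| ≤ Cχ := fun u => by rw [abs_of_nonneg (hχ0 u)]; exact hCχ u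
  have hΩm : Measurable Ω := measurable_frozenProfile hqfm rf β
  have hfm : Measurable (boFun L χ₀ Ω) := measurable_boFun L hχm hΩm
  have hfb : ∀ U, |boFun L χ₀ Ω U| ≤ Cχ * 1 := fun U => abs_boFun_le L hχabs (abs_frozenProfile_le hqf0 rf β) U
  have hf0 : ∀ U, 0 ≤ boFun L χ₀ Ω U := fun U => by
    unfold boFun; exact mul_nonneg (Set.indicator_nonneg (fun _ _ => zero_le_one) _) (mul_nonneg (hχ0 _) (frozenProfile_mem_Icc hqf0 rf β _).1)
  have hfinv : ∀ (c' : SU2) (U : GaugeConfig 3 L SU2), boFun L χ₀ Ω (gaugeTransform (fun _ : Site 3 L => c') U) = boFun L χ₀ Ω U :=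
    boFun_conj hχinv (fun c' x => frozenProfile_adL hqfinv rf β c' x)
  obtain ⟨_, hAup, _⟩ := localisedAvg_coreWeight (L := L) ε R₁' hZ0 hZ hfm hfb hf0 hfinv V
  exact le_trans hAup (mul_le_mul_of_nonneg_left hhi' hZ0)

end Summit.QuantumFields.YangMills.Theorems.FemtoTransferGap.TwoLattice.ConstTube

end
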